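/-
Copyright (c) 2026 the pub-hodgecm-mathlib formalisation cell (harness21).  Prover seat hodgecm-mathlib-K2E3-p27 (g2), R90-TF SLAB section S3
(Rogawski Ch. 12 endoscopic character identities), hand p08 «FINITE LENGTH OF THE PRINCIPAL SERIES» (b) of the S3 dealer R90-C12-plan (g0), R90 bus
2026-09-04T16:16:30Z; h413 = `stmt-HodgeConjecture-24833`.
-/
import Summits.HodgeConjecture.HodgeConjecture.Theorems.R90S3IsFiniteLengthOfChainBound     -- ★ (a) (this seat): «no chain `⊥ < N₁ < N₂ < ⊤`» ⇒ `IsFiniteLength`, order-iso transport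
import Summits.HodgeConjecture.HodgeConjecture.Theorems.K2E3U3PrincipalSeriesJHStructure     -- ★ (K2E3-p26): `not_bot_lt_lt_lt_top_cmPrincipalSeries_three` (every `χ`, non-split `v`; N1∕N2∕N3 ★ `_holds`)
import Summits.HodgeConjecture.HodgeConjecture.Theorems.K2E3U2PrincipalSeriesNoThreeChain     -- ★ D121 (K2E3-p26): `not_bot_lt_lt_lt_top_cmPrincipalSeries_two` (every `χ`, non-split `v`)
import Literature.NumberTheory.Automorphic.UnitaryGroupPrincipalSeriesHLattice                 -- ★ `subrepresentationCMPrincipalSeriesHOrderIso` (`i_H(χ₂ ⊠ χ₁)` ↔ `i(χ₂)` lattices)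
import HarnessLib

/-!
# R90 · S3 · p08 (b) — THE PRINCIPAL SERIES OF `U(3)_v`, `U(2)_v` AND `H_v = U(2)_v × U(1)_v` AT A NON-SPLIT PLACE HAVE FINITE LENGTH (every character `χ`)

Cell `pub/hodgecm-mathlib`, crux H413 = `stmt-HodgeConjecture-24833`, route of record `HCCMUnconditional`; R90-TF SLAB section S3 (dealer R90-C12-plan (g0); chair
K2-lead (g2)), hand p08 (b).  THEOREMS ONLY (★-only imports; no definition, no instance, no notation, no named-fact hypothesis, no `sorry`); lane
`--kind proof --supports stmt-HodgeConjecture-24833 --as helper`; namespace `Summit.HodgeConjecture.HodgeConjecture.R90.S3`.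

WHY ∕ WHAT.  Support lemma on the discharge road of FILE E's `stub_R90_S3_print_492` (L. 4.9.2 signed): p03's ★ p861751 `R90.S3.endoExpansion_exists_of_indPS` takes in `h492` a
representation `I` of `G_v` with `I.IsAdmissible ∧ IsFiniteLength (MonoidAlgebra ℂ G_v) I.asModule ∧ …`; in print `I = i_G(χ̃)` and «if `i_G(χ)` is reducible, it contains exactly two
irreducible constituents ([BZ])» [Rogawski1990, §12.2 p. 173] — finite length is implicit.  The tree PROVES the two-constituent bound UNCONDITIONALLY as «no chain `⊥ < N₁ < N₂ < ⊤` of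
subrepresentations» — ★ `not_bot_lt_lt_lt_top_cmPrincipalSeries_three` (Casselman Cor. 7.1.2 for `U(Φ₃)(L⁺_v)`: N1 `U3PrincipalSeriesJacquetFiltration_holds`, N2, N3
`u3PrincipalSeriesLengthLeTwo_holds` are ★ theorems, not hypotheses — CENSUS 2026-09-04T16:25Z, so the dealer's `(hN1) (hN2)` binders are NOT needed), ★ D121
`not_bot_lt_lt_lt_top_cmPrincipalSeries_two` (`U(Φ₂)(L⁺_v)`) — and ★ `subrepresentationCMPrincipalSeriesHOrderIso` identifies the lattice of `i_H(χ₂ ⊠ χ₁)` with that of `i(χ₂)`.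
With ★ (a) `isFiniteLength_asModule_of_forall_not_bot_lt_lt_lt_top` this gives, for EVERY character `χ` (continuous or not) at a NON-SPLIT `v`:
* §1 **`isFiniteLength_cmPrincipalSeries_three`** — `IsFiniteLength (MonoidAlgebra ℂ U(Φ₃)(L⁺_v)) (cmPrincipalSeries L 3 v χ).asModule`; pair form `…_torusCharPair` (the dealer's
  `cmTorusCharPair L v χ₁ χ₂` spelling);
* §2 **`isFiniteLength_cmPrincipalSeries_two`** — the `U(Φ₂)(L⁺_v) ≅ U(1,1)` twin;
* §3 **`isFiniteLength_cmPrincipalSeriesH`** — `i_H(χ₂ ⊠ χ₁)` on `H_v = U(Φ₂)_v × U(Φ₁)_v` (`not_bot_lt_lt_lt_top_cmPrincipalSeriesH` first, by lattice reduction).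
CARRIER SPELLING (dealer's question): the `U(3)`∕`U(2)` statements are on ★ `cmPrincipalSeries`'s own carrier `↥(unitaryGroupOfForm (conjLocal L c v) (cmLocalForm L N v))`, which IS
`(cmDatum L N Φ_N).Local v` by `rfl` (★ `cmDatum_Local_eq`), so A1∕E consumers at `H′ = Φ₃` read them directly; for an inner form `H′` with `U(H′)(L⁺_v) ≃ₜ* U(Φ₃)(L⁺_v)` (★
`cmDatumLocalCongr`) the chain hypothesis transports along the induced lattice isomorphism by ★ (a) `forall_not_bot_lt_lt_lt_top_of_orderIso` — not instantiated here (no consumer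
bytes yet).

HONEST LABEL.  Count-neutral helper (closes no socket: `print_492` stays a universal printed socket; this discharges only its finite-length conjunct in the record frame); HC_CM is proved
only modulo the 7 printed citations (2 remaining named inputs: hLiu418 = `stmt-HodgeConjecture-24832`, h413 = `stmt-HodgeConjecture-24833`) until rung 0 closes; REL ≠ ★ ≠ BUILT.

## References
* [Rogawski1990] J. D. Rogawski, *Automorphic Representations of Unitary Groups in Three Variables*, Ann. of Math. Stud. 123 (1990), §12.1 pp. 171–172 (`i_H(χ)`), §12.2 p. 173
  («exactly two irreducible constituents ([BZ])»), §4.9 L. 4.9.2 p. 55.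
* [Casselman1995] W. Casselman, *Introduction to the theory of admissible representations of 𝔭-adic reductive groups* (1995), Lemma 7.1.1 (a), Cor. 7.1.2 p. 67.
* [BernsteinZelevinsky1977] I. N. Bernstein, A. V. Zelevinsky, *Induced representations of reductive 𝔭-adic groups I*, Ann. Sci. ÉNS 10 (1977), Thm. 2.8.
-/

set_option autoImplicit false
-- the mandated namespace repeats `HodgeConjecture.HodgeConjecture`, as in every `Theorems/*.lean` of this sub-problem
set_option linter.dupNamespace false

noncomputable section

open NumberField IsDedekindDomain
open scoped Matrix MatrixGroups
open Literature.NumberTheory.Automorphic Literature.NumberTheory.Automorphic.UnitaryGroup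

namespace Summit.HodgeConjecture.HodgeConjecture.R90.S3

open Summit.HodgeConjecture.HodgeConjecture.Cruxes.H413

variable (L : Type) [Field L] [NumberField L] [IsCMField L] (v : HeightOneSpectrum (𝓞 ↥(maximalRealSubfield L)))

/-! ## §1 `U(Φ₃)(L⁺_v)`: `i_G(χ)` has finite length -/

/-- **THE PRINCIPAL SERIES `i_G(χ)` OF `U(Φ₃)(L⁺_v)` AT A NON-SPLIT `v` HAS FINITE LENGTH, for EVERY character `χ` of the diagonal torus** (as a module over the monoid
algebra `ℂ[U(Φ₃)(L⁺_v)]`): ★ `not_bot_lt_lt_lt_top_cmPrincipalSeries_three` (no chain `⊥ < N₁ < N₂ < ⊤`, Casselman Cor. 7.1.2 — N1∕N2∕N3 ★) + ★ (a).  The `IsFiniteLength` conjunct of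
p03's `h492` for `I = i_G(χ̃)`. [cite: Rogawski1990, §12.2 p. 173] [cite: Casselman1995, Cor. 7.1.2 p. 67] [cite: BernsteinZelevinsky1977, Thm. 2.8] -/
theorem isFiniteLength_cmPrincipalSeries_three (hns : ∀ w : PlacesOver L v, IsCMField.complexConj L • w.1 = w.1) (χ : ↥(cmBorelTriple L 3 v).M →* ℂˣ) :
    IsFiniteLength (MonoidAlgebra ℂ ↥(unitaryGroupOfForm (conjLocal L (IsCMField.complexConj L) v) (cmLocalForm L 3 v)))
      (haveI := locallyCompactSpace_cmBorelU L 3 v; cmPrincipalSeries L 3 v χ).asModule :=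
  haveI := locallyCompactSpace_cmBorelU L 3 v
  isFiniteLength_asModule_of_forall_not_bot_lt_lt_lt_top (cmPrincipalSeries L 3 v χ)
    (K2E3U3PrincipalSeriesJHStructure.not_bot_lt_lt_lt_top_cmPrincipalSeries_three L v hns χ)

/-- The same in print's coordinates `χ = (χ₁, χ₂)` (★ `cmTorusCharPair L v χ₁ χ₂`, the dealer's spelling; `i_G(χ) = datum_S1ns L v χ₁ χ₂` of S1-A).
[cite: Rogawski1990, §12.1 p. 171; §12.2 p. 173] [cite: Casselman1995, Cor. 7.1.2 p. 67] -/
theorem isFiniteLength_cmPrincipalSeries_three_torusCharPair (hns : ∀ w : PlacesOver L v, IsCMField.complexConj L • w.1 = w.1)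
    (χ₁ : (LocalRing L v)ˣ →* ℂˣ) (χ₂ : ↥(normOneUnits (conjLocal L (IsCMField.complexConj L) v)) →* ℂˣ) :
    IsFiniteLength (MonoidAlgebra ℂ ↥(unitaryGroupOfForm (conjLocal L (IsCMField.complexConj L) v) (cmLocalForm L 3 v)))
      (haveI := locallyCompactSpace_cmBorelU L 3 v; cmPrincipalSeries L 3 v (cmTorusCharPair L v χ₁ χ₂)).asModule :=
  isFiniteLength_cmPrincipalSeries_three L v hns (cmTorusCharPair L v χ₁ χ₂)

/-! ## §2 `U(Φ₂)(L⁺_v) ≅ U(1,1)`: `i(χ)` has finite length -/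

/-- **THE PRINCIPAL SERIES `i(χ)` OF `U(Φ₂)(L⁺_v)` AT A NON-SPLIT `v` HAS FINITE LENGTH, every `χ`** (★ D121 `not_bot_lt_lt_lt_top_cmPrincipalSeries_two` + ★ (a)).
[cite: Rogawski1990, §12.1 p. 171] [cite: Casselman1995, Cor. 7.1.2 p. 67] -/
theorem isFiniteLength_cmPrincipalSeries_two (hns : ∀ w : PlacesOver L v, IsCMField.complexConj L • w.1 = w.1) (χ : ↥(cmBorelTriple L 2 v).M →* ℂˣ) :
    IsFiniteLength (MonoidAlgebra ℂ ↥(unitaryGroupOfForm (conjLocal L (IsCMField.complexConj L) v) (cmLocalForm L 2 v)))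
      (haveI := locallyCompactSpace_cmBorelU L 2 v; cmPrincipalSeries L 2 v χ).asModule :=
  haveI := locallyCompactSpace_cmBorelU L 2 v
  isFiniteLength_asModule_of_forall_not_bot_lt_lt_lt_top (cmPrincipalSeries L 2 v χ)
    (K2E3U2PrincipalSeriesNoThreeChain.not_bot_lt_lt_lt_top_cmPrincipalSeries_two L v hns χ)

/-! ## §3 `H_v = U(Φ₂)_v × U(Φ₁)_v`: `i_H(χ₂ ⊠ χ₁)` has no chain `⊥ < N₁ < N₂ < ⊤` and finite length -/

set_option synthInstance.maxHeartbeats 400000 in  -- instance paths on the CM carrier `∏_{w ∣ v} L_w` (as ★ D121)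
set_option maxHeartbeats 2000000 in  -- the `rfl`-bridge `(cmDatum L 2 Φ₂).Local v = ↥(unitaryGroupOfForm … (cmLocalForm L 2 v))` between ★ HLattice's and ★ D121's spellings (as ★ D121, 2 M)
/-- **NO CHAIN `⊥ < N₁ < N₂ < ⊤` IN `i_H(χ₂ ⊠ χ₁)`** at a non-split `v` (★ lattice reduction `subrepresentationCMPrincipalSeriesHOrderIso` to `i(χ₂)` on `U(Φ₂)_v` + ★ D121;
★ (a) `forall_not_bot_lt_lt_lt_top_of_orderIso`).  Heartbeats: the order isomorphism is typed in ★ `cmPrincipalSeriesH`'s `(cmDatum L 2 Φ₂).Local v` spelling and ★ D121 in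
★ `cmPrincipalSeries`'s `unitaryGroupOfForm … (cmLocalForm L 2 v)` spelling — the same type by `rfl` (★ `cmDatum_Local_eq`), but the `whnf` bridge costs > 200 k heartbeats (exactly the
budget ★ D121 ∕ ★ `K2E3U3PrincipalSeriesJHStructure` pin for the same bridge: 2 M ∕ synth 400 k). [cite: Rogawski1990, §12.1 pp. 171–172] [cite: Casselman1995, Cor. 7.1.2 p. 67] -/
theorem not_bot_lt_lt_lt_top_cmPrincipalSeriesH (hns : ∀ w : PlacesOver L v, IsCMField.complexConj L • w.1 = w.1)
    (χ₂ : ↥(torusU (conjLocal L (IsCMField.complexConj L) v) (cmLocalForm L 2 v)) →* ℂˣ)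
    (χ₁ : (cmDatum L 1 (Matrix.of fun i j : Fin 1 => if i.val + j.val + 1 = 1 then (1 : L) else 0)).Local v →* ℂˣ)
    (N₁ N₂ : Subrepresentation (cmPrincipalSeriesH L v χ₂ χ₁)) : ¬ (⊥ < N₁ ∧ N₁ < N₂ ∧ N₂ < ⊤) :=
  forall_not_bot_lt_lt_lt_top_of_orderIso (subrepresentationCMPrincipalSeriesHOrderIso L v χ₂ χ₁)
    (K2E3U2PrincipalSeriesNoThreeChain.not_bot_lt_lt_lt_top_cmPrincipalSeries_two L v hns χ₂) N₁ N₂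

/-- **THE PRINCIPAL SERIES `i_H(χ₂ ⊠ χ₁)` OF `H_v = U(Φ₂)_v × U(Φ₁)_v` AT A NON-SPLIT `v` HAS FINITE LENGTH** (every `χ₂`, `χ₁`).
[cite: Rogawski1990, §12.1 pp. 171–172] [cite: Casselman1995, Cor. 7.1.2 p. 67] -/
theorem isFiniteLength_cmPrincipalSeriesH (hns : ∀ w : PlacesOver L v, IsCMField.complexConj L • w.1 = w.1)
    (χ₂ : ↥(torusU (conjLocal L (IsCMField.complexConj L) v) (cmLocalForm L 2 v)) →* ℂˣ)
    (χ₁ : (cmDatum L 1 (Matrix.of fun i j : Fin 1 => if i.val + j.val + 1 = 1 then (1 : L) else 0)).Local v →* ℂˣ) :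
    IsFiniteLength
      (MonoidAlgebra ℂ ((cmDatum L 2 (Matrix.of fun i j : Fin 2 => if i.val + j.val + 1 = 2 then (1 : L) else 0)).Local v ×
        (cmDatum L 1 (Matrix.of fun i j : Fin 1 => if i.val + j.val + 1 = 1 then (1 : L) else 0)).Local v))
      (cmPrincipalSeriesH L v χ₂ χ₁).asModule :=
  isFiniteLength_asModule_of_forall_not_bot_lt_lt_lt_top (cmPrincipalSeriesH L v χ₂ χ₁) (not_bot_lt_lt_lt_top_cmPrincipalSeriesH L v hns χ₂ χ₁)

end Summit.HodgeConjecture.HodgeConjecture.R90.S3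

end
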